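import Summits.BirchSwinnertonDyer.BirchSwinnertonDyer.Theorems.SylvesterTwoHeegnerIndexUpperOffV0Conjugation
import Literature.NumberTheory.EllipticCurves.GaloisActionProofs
import HarnessLib

/-!
# K7t crux `UpperOffV0HSY` (item 19581): the mod-`2` Galois module of `y² = x³ − c` is irreducible and
# absolutely irreducible (the image is `S₃ = GL₂(𝔽₂)`), in the shapes consumed by McCallum's Step B

Route `SylvesterTwoHeegnerIndex` (cell bsd-cm, rung K7t).  The Čebotarev step of the tree's Kolyvagin
descent (`IsLiftOfAut.exists_h1Eval_conj_mul_order`, McCallum 1991 Prop. 3.1 / Cor. 3.2, Step B)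
takes the two standing image hypotheses of McCallum §3 in the forms
`hS : every Γ_K-stable subgroup of E[p] is ⊥ or ⊤` and
`hC : every Γ_K-equivariant endomorphism of E[p] is a scalar`,
there obtained from `ρ̄_{E,p}` onto `GL₂(𝔽_p)` for `p` odd (`KolyvaginImage.*`).  For the CM curves
`y² = x³ − c` at `p = 2` this file PROVES both directly, for every `F`-model `B`:

* `two_torsion_subgroup_eq_bot_or_top` (`hS` at `2`) — if `∛c ∉ F`: an element of `Γ_{F(ω)}` moving
  `∛c` acts on `E[2] ≅ 𝔽₄` without fixed vector (`EisensteinTorsion.eq_zero_of_apply_eq_self_of_commute`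
  at `M = 1`), so a stable subgroup containing `t ≠ 0` contains `t, zt, t + zt`: all of `E[2]`;
* `two_torsion_equivariant_eq_smul` (`hC` at `2`) — if moreover `ω ∉ F` (e.g. `F = ℚ`, or `F = K` an
  imaginary quadratic field other than `ℚ(√−3)`): an equivariant `f` commutes with that `3`-cycle,
  hence with `[ω]`, so `f = a + b[ω]` (`EisensteinTorsion.apply_eq_lin_of_commute`), and commuting
  with an element `τ'` with `τ'(ω) = ω²` (which exists as `ω ∉ F`, and is `[ω]`-semilinear,
  `exists_omega_geomPoints_semilinear`) forces `b` even: `f = a`.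

Together: `Γ_F → Aut(E[2]) ≅ S₃` is onto (a `3`-cycle and an element outside `C₃`); we record the two
consumable consequences rather than the permutation-group statement.
NOT the crux: inputs of Step B of the off-𝒱₀ 2-adic Kolyvagin line; the sharp bound stays open.
-/

noncomputable section

open scoped Classical
open Field WeierstrassCurve Literature.NumberTheory.EllipticCurves
  Literature.NumberTheory.GaloisRepresentations

set_option autoImplicit false
set_option linter.dupNamespace false

namespace Summit.BirchSwinnertonDyer.BirchSwinnertonDyer.Theorems.SylvesterTwoUpper

universe u

variable {F : Type u} [Field F] [NumberField F]

/-- **`[ω]` on `E_B[2]` with its Galois behaviour, the count `#E[2] = 4` and a point of order `2`**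
(the `M = 1` set-up of `conj_eigen_structure_twoPow`, recorded for reuse). [folklore] -/
theorem exists_theta_two_torsion {c : F} (B : WeierstrassCurve F) [B.IsElliptic] {C : VariableChange F}
    (hCB : C • B = ⟨0, 0, 0, 0, -c⟩) {ω : AlgebraicClosure F} (hω : ω ^ 2 + ω + 1 = 0) :
    ∃ θ : geomTorsion B ((2 : ℕ) : ℤ) →+ geomTorsion B ((2 : ℕ) : ℤ),
      (∀ T, θ (θ T) + θ T + T = 0) ∧
      (∀ σ : absoluteGaloisGroup F, σ • ω = ω → ∀ T, σ • θ T = θ (σ • T)) ∧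
      (∀ σ : absoluteGaloisGroup F, σ • ω = ω ^ 2 → ∀ T, σ • θ T = θ (θ (σ • T))) ∧
      Nat.card (geomTorsion B ((2 : ℕ) : ℤ)) = 4 ^ 1 ∧
      ∃ P : geomTorsion B ((2 : ℕ) : ℤ), addOrderOf P = 2 ^ 1 := by
  haveI hV : (C • B).IsElliptic := inferInstance
  obtain ⟨θ, hθrel, hθcomm, hθsemi⟩ := exists_omega_geomPoints_semilinear (V := C • B) (by rw [hCB])
    (by rw [hCB]) (by rw [hCB]) (by rw [hCB]) hω rfl
  haveI : Finite (geomTorsion B ((2 : ℕ) : ℤ)) := B.finite_geomTorsion_nat two_ne_zero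
  have hmem : ∀ Q : geomPoints B, Q ∈ geomTorsion B ((2 : ℕ) : ℤ) ↔ ((2 : ℕ) : ℤ) • Q = 0 := fun Q =>
    Submodule.mem_torsionBy_iff ((2 : ℕ) : ℤ) Q
  have hθmem : ∀ T : geomTorsion B ((2 : ℕ) : ℤ), θ (T : geomPoints B) ∈ geomTorsion B ((2 : ℕ) : ℤ) := by
    intro T
    rw [hmem, ← map_zsmul, (hmem _).mp T.2, map_zero]
  let θN : geomTorsion B ((2 : ℕ) : ℤ) →+ geomTorsion B ((2 : ℕ) : ℤ) :=
    { toFun := fun T => ⟨θ T, hθmem T⟩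
      map_zero' := Subtype.ext (by simp)
      map_add' := fun T T' => Subtype.ext (by simp) }
  have hcard : Nat.card (geomTorsion B ((2 : ℕ) : ℤ)) = 4 ^ 1 := by
    rw [pow_one, show (4 : ℕ) = 2 ^ 2 by norm_num]
    exact card_torsionPoints_eq_sq_holds B (AlgebraicClosure F) (n := 2) (by norm_num)
  obtain ⟨P₀, hP₀⟩ := WeierstrassCurve.exists_addOrderOf_eq (W := B) (m := 2) (by norm_num)
  refine ⟨θN, fun T => Subtype.ext (hθrel T), fun σ hσ T => Subtype.ext ?_, fun σ hσ T => Subtype.ext ?_,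
    hcard, P₀, by rw [pow_one]; exact hP₀⟩
  · simp only [AddSubgroup.torsionBy.coe_smul]
    exact hθcomm σ hσ T
  · simp only [AddSubgroup.torsionBy.coe_smul]
    exact hθsemi σ hσ T

/-- **`hS` at `p = 2`: `E[2]` is an irreducible `Γ_F`-module** for every `F`-model `B` of
`y² = x³ − c` with `∛c ∉ F`: a `Γ_F`-stable subgroup of `E_B[2]` is `⊥` or `⊤`.
[cite: McCallumLMS1991, §3 (standing hypotheses)] -/
theorem two_torsion_subgroup_eq_bot_or_top {c : F} (hc : ∀ x : F, x ^ 3 ≠ c)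
    (B : WeierstrassCurve F) [B.IsElliptic] {C : VariableChange F} (hCB : C • B = ⟨0, 0, 0, 0, -c⟩)
    (H : AddSubgroup (geomTorsion B ((2 : ℕ) : ℤ)))
    (hH : ∀ g : absoluteGaloisGroup F, ∀ t ∈ H, g • t ∈ H) : H = ⊥ ∨ H = ⊤ := by
  haveI hV : (C • B).IsElliptic := inferInstance
  haveI : Finite (geomTorsion B ((2 : ℕ) : ℤ)) := B.finite_geomTorsion_nat two_ne_zero
  obtain ⟨ω, hω⟩ : ∃ ω : AlgebraicClosure F, ω ^ 2 + ω + 1 = 0 := by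
    obtain ⟨ω, hω⟩ := IsAlgClosed.exists_root
      (Polynomial.X ^ 2 + Polynomial.X + 1 : Polynomial (AlgebraicClosure F))
      (by rw [show (Polynomial.X ^ 2 + Polynomial.X + 1 : Polynomial (AlgebraicClosure F)).degree
        = 2 by compute_degree!]; norm_num)
    exact ⟨ω, by simpa [Polynomial.IsRoot] using hω⟩
  obtain ⟨x₀, hx₀⟩ : ∃ x₀ : AlgebraicClosure F, x₀ ^ 3 = algebraMap F (AlgebraicClosure F) c :=
    IsAlgClosed.exists_pow_nat_eq _ (by norm_num)
  obtain ⟨z, hzω, hzx⟩ := exists_smul_omega_eq_and_smul_ne hc hω hx₀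
  obtain ⟨θ, hθrel, hθcomm, -, hcard, P₀, hP₀⟩ := exists_theta_two_torsion B hCB hω
  obtain ⟨t₀, h2t₀, hzt₀⟩ := exists_two_torsion_smul_ne (V := C • B) (by rw [hCB]) (by rw [hCB])
    (by rw [hCB]) (by rw [hCB]) rfl (c := c) (by rw [hCB]) hx₀ z hzx
  have hmem : ∀ Q : geomPoints B, Q ∈ geomTorsion B ((2 : ℕ) : ℤ) ↔ ((2 : ℕ) : ℤ) • Q = 0 := fun Q =>
    Submodule.mem_torsionBy_iff ((2 : ℕ) : ℤ) Q
  have ht₀mem : t₀ ∈ geomTorsion B ((2 : ℕ) : ℤ) := by rw [hmem, natCast_zsmul, h2t₀]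
  -- `z` has no fixed vector on `E[2]`
  set g : geomTorsion B ((2 : ℕ) : ℤ) →+ geomTorsion B ((2 : ℕ) : ℤ) :=
    DistribSMul.toAddMonoidHom _ z with hg
  have hgθ : ∀ T, g (θ T) = θ (g T) := fun T => by
    simp only [hg, DistribSMul.toAddMonoidHom_apply]; exact hθcomm z hzω T
  have hfix : ∀ T : geomTorsion B ((2 : ℕ) : ℤ), z • T = T → T = 0 := fun T hT =>
    EisensteinTorsion.eq_zero_of_apply_eq_self_of_commute θ hθrel hcard hP₀ le_rfl g hgθ
      (MulAction.injective z) (t := ⟨t₀, ht₀mem⟩) (Subtype.ext h2t₀)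
      (fun h => hzt₀ (congrArg Subtype.val h)) hT
  -- a stable `H ≠ ⊥` has at least three elements, hence is everything
  rcases eq_or_ne H ⊥ with h | hne
  · exact Or.inl h
  right
  obtain ⟨⟨t, htH⟩, ht0'⟩ := AddSubgroup.ne_bot_iff_exists_ne_zero.mp hne
  have ht0 : t ≠ 0 := fun h => ht0' (Subtype.ext h)
  have hzt : z • t ≠ t := fun h => ht0 (hfix t h)
  have hzt0 : z • t ≠ 0 := fun h => ht0 ((MulAction.injective z) (h.trans (smul_zero z).symm))
  have hcardH : Nat.card H ∣ 4 := by
    rw [← pow_one 4, ← hcard]; exact AddSubgroup.card_addSubgroup_dvd_card H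
  have h3 : 3 ≤ Nat.card H := by
    haveI : Fintype H := Fintype.ofFinite H
    have h1 : (⟨0, H.zero_mem⟩ : H) ∉ ({⟨t, htH⟩, ⟨z • t, hH z _ htH⟩} : Finset H) := by
      simp only [Finset.mem_insert, Finset.mem_singleton, not_or]
      exact ⟨fun h => ht0 (Subtype.mk_eq_mk.mp h).symm, fun h => hzt0 (Subtype.mk_eq_mk.mp h).symm⟩
    have h2 : (⟨t, htH⟩ : H) ≠ ⟨z • t, hH z _ htH⟩ := fun h => hzt (Subtype.mk_eq_mk.mp h).symm
    calc 3 = ({⟨0, H.zero_mem⟩, ⟨t, htH⟩, ⟨z • t, hH z _ htH⟩} : Finset H).card := by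
          rw [Finset.card_insert_of_notMem h1, Finset.card_pair h2]
      _ ≤ Fintype.card H := Finset.card_le_univ _
      _ = Nat.card H := Nat.card_eq_fintype_card.symm
  have h4 : Nat.card H = 4 := by
    have : Nat.card H ∈ Nat.divisors 4 := Nat.mem_divisors.mpr ⟨hcardH, by norm_num⟩
    have hd : Nat.divisors 4 = {1, 2, 4} := by decide
    rw [hd] at this
    simp only [Finset.mem_insert, Finset.mem_singleton] at this
    omega
  exact AddSubgroup.eq_top_of_card_eq H (by rw [h4, hcard, pow_one])

/-- **`hC` at `p = 2`: `E[2]` is absolutely irreducible** — every `Γ_F`-equivariant additive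
endomorphism of `E_B[2]` is a scalar — for every `F`-model `B` of `y² = x³ − c` with `∛c ∉ F` and
`ω ∉ F` (no root of `X² + X + 1` in `F`; e.g. `F = ℚ`, or an imaginary quadratic `K ≠ ℚ(√−3)`).
[cite: McCallumLMS1991, §3 (standing hypotheses)] -/
theorem two_torsion_equivariant_eq_smul {c : F} (hc : ∀ x : F, x ^ 3 ≠ c)
    (hωF : ∀ x : F, x ^ 2 + x + 1 ≠ 0)
    (B : WeierstrassCurve F) [B.IsElliptic] {C : VariableChange F} (hCB : C • B = ⟨0, 0, 0, 0, -c⟩)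
    (f : geomTorsion B ((2 : ℕ) : ℤ) →+ geomTorsion B ((2 : ℕ) : ℤ))
    (hf : ∀ (g : absoluteGaloisGroup F) (t : geomTorsion B ((2 : ℕ) : ℤ)), f (g • t) = g • f t) :
    ∃ k : ℤ, ∀ t, f t = k • t := by
  haveI hV : (C • B).IsElliptic := inferInstance
  haveI : Finite (geomTorsion B ((2 : ℕ) : ℤ)) := B.finite_geomTorsion_nat two_ne_zero
  haveI : IsGalois F (AlgebraicClosure F) := {}
  obtain ⟨ω, hω⟩ : ∃ ω : AlgebraicClosure F, ω ^ 2 + ω + 1 = 0 := by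
    obtain ⟨ω, hω⟩ := IsAlgClosed.exists_root
      (Polynomial.X ^ 2 + Polynomial.X + 1 : Polynomial (AlgebraicClosure F))
      (by rw [show (Polynomial.X ^ 2 + Polynomial.X + 1 : Polynomial (AlgebraicClosure F)).degree
        = 2 by compute_degree!]; norm_num)
    exact ⟨ω, by simpa [Polynomial.IsRoot] using hω⟩
  obtain ⟨x₀, hx₀⟩ : ∃ x₀ : AlgebraicClosure F, x₀ ^ 3 = algebraMap F (AlgebraicClosure F) c :=
    IsAlgClosed.exists_pow_nat_eq _ (by norm_num)
  obtain ⟨z, hzω, hzx⟩ := exists_smul_omega_eq_and_smul_ne hc hω hx₀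
  obtain ⟨θ, hθrel, hθcomm, hθsemi, hcard, P₀, hP₀⟩ := exists_theta_two_torsion B hCB hω
  obtain ⟨t₀, h2t₀, hzt₀⟩ := exists_two_torsion_smul_ne (V := C • B) (by rw [hCB]) (by rw [hCB])
    (by rw [hCB]) (by rw [hCB]) rfl (c := c) (by rw [hCB]) hx₀ z hzx
  have hmem : ∀ Q : geomPoints B, Q ∈ geomTorsion B ((2 : ℕ) : ℤ) ↔ ((2 : ℕ) : ℤ) • Q = 0 := fun Q =>
    Submodule.mem_torsionBy_iff ((2 : ℕ) : ℤ) Q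
  have h2N : ∀ T : geomTorsion B ((2 : ℕ) : ℤ), (2 : ℤ) • T = 0 := fun T =>
    Subtype.ext (by exact_mod_cast (hmem _).mp T.2)
  have ht₀mem : t₀ ∈ geomTorsion B ((2 : ℕ) : ℤ) := by rw [hmem, natCast_zsmul, h2t₀]
  -- an element `τ'` with `τ'(ω) = ω²` (exists as `ω ∉ F`)
  obtain ⟨τ', hτ'⟩ : ∃ τ' : absoluteGaloisGroup F, τ' • ω = ω ^ 2 := by
    by_contra hall
    have hfixed : ∀ σ : absoluteGaloisGroup F, σ • ω = ω := fun σ =>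
      (smul_omega_eq_or hω σ).resolve_right fun h => hall ⟨σ, h⟩
    obtain ⟨x, hx⟩ := (InfiniteGalois.mem_range_algebraMap_iff_fixed ω).mpr hfixed
    apply hωF x
    apply (algebraMap F (AlgebraicClosure F)).injective
    rw [map_add, map_add, map_pow, map_one, map_zero, hx, hω]
  -- the action of `z` is `a + bθ` with `b` odd, so `f` commutes with `θ`
  set g : geomTorsion B ((2 : ℕ) : ℤ) →+ geomTorsion B ((2 : ℕ) : ℤ) :=
    DistribSMul.toAddMonoidHom _ z with hg
  have hgθ : ∀ T, g (θ T) = θ (g T) := fun T => by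
    simp only [hg, DistribSMul.toAddMonoidHom_apply]; exact hθcomm z hzω T
  obtain ⟨a, b, hgP⟩ := EisensteinTorsion.exists_lin_eq θ hθrel hcard hP₀ (g P₀)
  have hglin := EisensteinTorsion.apply_eq_lin_of_commute θ hθrel hcard hP₀ g hgθ hgP
  have hb : ¬ (2 : ℤ) ∣ b := by
    rintro ⟨b₁, rfl⟩
    -- then `z` acts as the scalar `a`, which is odd (injectivity), so `z` fixes `t₀`
    have hga : ∀ T, g T = a • T := fun T => by
      rw [hglin T, mul_comm, mul_zsmul, h2N, smul_zero, add_zero]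
    obtain ⟨a₁, ha⟩ := Int.even_or_odd' a
    have hzt : z • (⟨t₀, ht₀mem⟩ : geomTorsion B ((2 : ℕ) : ℤ)) = ⟨t₀, ht₀mem⟩ := by
      have e := hga ⟨t₀, ht₀mem⟩
      simp only [hg, DistribSMul.toAddMonoidHom_apply] at e
      rw [e]
      rcases ha with rfl | rfl
      · exfalso
        have h0 : z • P₀ = 0 := by
          have e0 := hga P₀
          simp only [hg, DistribSMul.toAddMonoidHom_apply] at e0
          rw [e0, mul_zsmul, h2N]
        have : P₀ = 0 := MulAction.injective z (h0.trans (smul_zero z).symm)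
        rw [this, addOrderOf_zero] at hP₀
        norm_num at hP₀
      · rw [add_zsmul, one_zsmul, mul_zsmul, h2N, zero_add]
    exact hzt₀ (congrArg Subtype.val hzt)
  have hfθ : ∀ T, f (θ T) = θ (f T) := by
    intro T
    have e := hf z T
    have e1 : z • T = g T := rfl
    have e2 : z • f T = g (f T) := rfl
    rw [e1, e2, hglin, hglin, map_add, map_zsmul, map_zsmul] at e
    -- e : a • f T + b • f (θ T) = a • f T + b • θ (f T)
    have e' : b • f (θ T) = b • θ (f T) := add_left_cancel e
    obtain ⟨b₁, hb₁⟩ := Int.even_or_odd' b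
    rcases hb₁ with rfl | rfl
    · exact absurd ⟨b₁, by ring⟩ hb
    · rwa [add_zsmul, add_zsmul, one_zsmul, one_zsmul, mul_zsmul, mul_zsmul, h2N, h2N,
        zero_add, zero_add] at e'
  -- so `f = a' + b'θ`; commuting with the semilinear `τ'` forces `b'` even
  obtain ⟨a', b', hfP⟩ := EisensteinTorsion.exists_lin_eq θ hθrel hcard hP₀ (f P₀)
  have hflin := EisensteinTorsion.apply_eq_lin_of_commute θ hθrel hcard hP₀ f hfθ hfP
  have hb' : b' • P₀ = 0 := by
    -- compare `f (τ' • s)` and `τ' • f s` at `s = τ'⁻¹ • P₀`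
    set s : geomTorsion B ((2 : ℕ) : ℤ) := τ'⁻¹ • P₀ with hs
    have hs' : τ' • s = P₀ := by rw [hs, smul_inv_smul]
    have e := hf τ' s
    rw [hflin, hflin, smul_add, smul_comm τ' a', smul_comm τ' b', hθsemi τ' hτ', hs'] at e
    -- e : a' • P₀ + b' • θ P₀ = a' • P₀ + b' • θ (θ P₀)
    have e' : b' • θ P₀ = b' • θ (θ P₀) := add_left_cancel e
    have h2 := EisensteinTorsion.apply_apply_eq θ hθrel P₀
    rw [h2, smul_sub, smul_neg] at e'
    -- b'θP₀ = -b'θP₀ - b'P₀  ⇒  b'P₀ = -2b'θP₀ = 0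
    have e4 : b' • θ P₀ + b' • θ P₀ + b' • P₀ = 0 :=
      calc b' • θ P₀ + b' • θ P₀ + b' • P₀ = b' • θ P₀ - (-(b' • θ P₀) - b' • P₀) := by abel
        _ = 0 := sub_eq_zero.mpr e'
    calc b' • P₀ = (b' • θ P₀ + b' • θ P₀ + b' • P₀) - (2 : ℤ) • (b' • θ P₀) := by
          rw [two_zsmul]; abel
      _ = 0 := by rw [e4, h2N, sub_zero]
  have hb'2 : (2 : ℤ) ∣ b' := by
    have h := addOrderOf_dvd_iff_zsmul_eq_zero.mpr hb'
    rw [hP₀, pow_one] at h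
    exact_mod_cast h
  obtain ⟨b₁, rfl⟩ := hb'2
  refine ⟨a', fun t => ?_⟩
  rw [hflin t, mul_comm, mul_zsmul, h2N, smul_zero, add_zero]

end Summit.BirchSwinnertonDyer.BirchSwinnertonDyer.Theorems.SylvesterTwoUpper

end
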